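import Summits.QuantumFields.YangMills.Theorems.SwapVirialDeficitSigmaBallEndSlab
import Summits.QuantumFields.YangMills.Theorems.SwapVirialDeficitSigmaBallZLetter
import Summits.QuantumFields.YangMills.Theorems.SwapVirialDeficitBlowUpGnomonicBFibreDefs
import Summits.QuantumFields.YangMills.Theorems.SwapVirialDeficitSectorLaplaceBTubeFibred
import HarnessLib

/-!
# END-CORE LEADER FUBINI: the leader-side Tonelli composition of the Gaussian-half bricks U1 ∕ U1 ∕ U3 in w2's B-chart letters, read on `μ_B`
# (stub `stub_core_end` of skeleton ➎ — the LEADER HALF of LEAD sfw-p2 g99's `stub_end_gaussHalf` (22:11Z); free-hands support of ⟨stmt-QuantumFields-24197⟩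
# `SwapVirialDeficit.SwapGluedStiffness`; proposal w3 g67 22:13Z, abstract follower factor `W`)

After the followers are integrated at fixed hub and leaders (w2 g60's ✓`follower_laplace_ceiling`, matched by LEAD's smearing), the end-core Gaussian-half weight
is a LEADER integral against `μ_B = vol·((1+δ²)⁻¹)²·gnoDensity` of a product of one-block Boltzmann factors times a slab factor `W(δ, x₀, y₀)`.  This file does the
Tonelli bookkeeping ONCE, for an ARBITRARY measurable `g ≥ 0` and an ARBITRARY measurable slab factor `W`, in w2's B-chart (✓`gnoFibreBEquiv`: base `u ∈ ℝ²`, fibre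
blocks `t = (δ, x₀, y₀)`, `v = y⊥`, `z`, followers; ✓`volume_withDensity_eq_map_gnoFibreBEquiv`, ✓`volume_preserving_gnoFibreBBlocksEquiv`, ✓`volume_preserving_splitT`):
* §1 `lintegral_plane_pi_le` (U1 on `Fin 2 → ℝ`), `lintegral_zLetter_pi_le` (U3 on `Fin 3 → ℝ` with `gnomonicWeight`/`normSq3`), `normSq3_vec3`, `normSq3_eq`;
* §2 ★★★ `lintegral_blocks_leader_le` — on the block product space: IF for every leader point with `t 0 ∈ S` the follower integral of `G` is
  `≤ W(t)·[(1+t1²+|u|²)^{-2}e^{−c₁r(t)|u|²/(…)}]·[(1+t2²+|v|²)^{-2}e^{−c₂|v|²/(…)}]·[gnomonicWeight z·e^{−c₃|z|²/(1+|z|²)}]` (`r > 0` a.e.), THEN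
  `∫⁻_{t 0 ∈ S} G ≤ (π²/c₁)(π²/c₂)(2C₃/((1+c₃)√(1+c₃)))·∫⁻_{S×ℝ²} W·(1+x₀²)⁻¹(1+y₀²)⁻¹·r⁻¹` (`u` first — ✓`lintegral_uFirst_le` —, `v`, `z`, swap, slab);
* §3 ★★★ `lintegral_hubSlab_leader_le` — the same read on `ℝ × GnoCoord L`: `∫⁻_{δ ∈ S} g dμ_B ≤ …` under the same pointwise-in-leaders follower hypothesis, stated
  in the explicit letters `(t 0, ((t 1, u), (t 2, v)), z, F)` (`gnoFibreBEquiv_eq_blocks`, `measurable_blockPoint`).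
USE (→ LEAD ∕ w2): `S` = the end window, `r = B₀` (LEAD 21:56Z; `{B₀ = 0} = {0}` is null), `c₁ = b/(3·39600L⁶·(4/3))`, `c₂`, `c₃` from ✓`gnoDeficit_floor_yPerp` ∕ `_z`,
`W` = the matched follower factor; the remaining slab integral is ✓`lintegral_endSlab_le` (`36s^{1/3} + π²s`) times `sup W`.

HONEST LABEL: measure-theoretic bookkeeping (Tonelli, measure-preserving letter maps), no model content; `stub_core_end` (assembly ⧗ LEAD, followers w2) and stubs
core-tip ∕ 001-good, ⟨24197⟩ ∕ ⟨24194⟩ and every rung OPEN; own crux ⟨22884⟩ OPEN (blocked-on ⟨19935⟩); the Yang–Mills mass gap is NOT proved; no summit is proved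
by a line.  THEOREMS ONLY (0 `def`, 0 `sorry`), standard axioms.  Width seat ym-line-sfw-p2-w3 g67 (cell ym-idea-1, free hands), `--supports stmt-QuantumFields-24197`.
References: [folklore].
-/

set_option autoImplicit false
set_option synthInstance.maxSize 1024

noncomputable section

open MeasureTheory Set Real
open scoped ENNReal

namespace Summit.QuantumFields.YangMills.Theorems.SwapVirialDeficit.SigmaBall

open Summit.QuantumFields.YangMills.Theorems.SwapVirialDeficit.Gnomonic (gnomonicWeight piWeight normSq3)
open Summit.QuantumFields.YangMills.Theorems.SwapVirialDeficit.BlowUpRing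

variable {L : ℕ} [NeZero L]

/-! ## §1 The one-block integrals in letter form -/

/-- `normSq3 ![a, b, c] = a² + b² + c²`. [folklore] -/
theorem normSq3_vec3 (a b c : ℝ) : normSq3 ![a, b, c] = a ^ 2 + b ^ 2 + c ^ 2 := by
  simp [normSq3, Fin.sum_univ_three]

/-- `normSq3 z = z 0² + z 1² + z 2²`. [folklore] -/
theorem normSq3_eq (z : Fin 3 → ℝ) : normSq3 z = z 0 ^ 2 + z 1 ^ 2 + z 2 ^ 2 := by
  simp [normSq3, Fin.sum_univ_three]

/-- ★ U1 in the letters of an axial-plus-plane block: for `A = 1 + a²`-type weights,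
`∫⁻ v : Fin 2 → ℝ, ((A + (v0² + v1²))²)⁻¹ e^{−κ(v0²+v1²)/(A + v0² + v1²)} ≤ π²/(Aκ)`. [folklore] -/
theorem lintegral_plane_pi_le {A κ : ℝ} (hA : 0 < A) (hκ : 0 < κ) :
    ∫⁻ v : Fin 2 → ℝ, ENNReal.ofReal (((A + (v 0 ^ 2 + v 1 ^ 2)) ^ 2)⁻¹ * Real.exp (-(κ * (v 0 ^ 2 + v 1 ^ 2) / (A + (v 0 ^ 2 + v 1 ^ 2))))) ≤
      ENNReal.ofReal (π ^ 2 / (A * κ)) := by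
  have h := (volume_preserving_finTwoArrow ℝ).lintegral_comp (f := fun u : ℝ × ℝ =>
    ENNReal.ofReal (((A + (u.1 ^ 2 + u.2 ^ 2)) ^ 2)⁻¹ * Real.exp (-(κ * (u.1 ^ 2 + u.2 ^ 2) / (A + (u.1 ^ 2 + u.2 ^ 2))))))
    (Measurable.ennreal_ofReal (by fun_prop))
  simp only [MeasurableEquiv.finTwoArrow_apply] at h
  rw [h]
  exact lintegral_uFirst_le hA hκ

/-- ★ U3 in letter form: `∫⁻ z : Fin 3 → ℝ, gnomonicWeight z · e^{−c·normSq3 z/(1+normSq3 z)} ≤ 2C₃/((1+c)√(1+c))`. [folklore] -/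
theorem lintegral_zLetter_pi_le {c : ℝ} (hc : 0 < c) :
    ∫⁻ z : Fin 3 → ℝ, ENNReal.ofReal (gnomonicWeight z * Real.exp (-(c * normSq3 z / (1 + normSq3 z)))) ≤
      ENNReal.ofReal (2 * (∫ w : EuclideanSpace ℝ (Fin 3), ((1 + ‖w‖ ^ 2) ^ 2)⁻¹) / ((1 + c) * Real.sqrt (1 + c))) := by
  set f : EuclideanSpace ℝ (Fin 3) → ℝ≥0∞ := fun w => ENNReal.ofReal (((1 + ‖w‖ ^ 2) ^ 2)⁻¹ * Real.exp (-(c * ‖w‖ ^ 2 / (1 + ‖w‖ ^ 2)))) with hf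
  have hfm : Measurable f := by rw [hf]; exact Measurable.ennreal_ofReal (by fun_prop)
  have h := (PiLp.volume_preserving_toLp (Fin 3)).lintegral_comp (f := f) hfm
  have e : ∀ z : Fin 3 → ℝ, ‖(WithLp.toLp 2 z : EuclideanSpace ℝ (Fin 3))‖ ^ 2 = normSq3 z := by
    intro z
    rw [EuclideanSpace.real_norm_sq_eq]
    simp [normSq3]
  have key : ∀ z : Fin 3 → ℝ, ENNReal.ofReal (gnomonicWeight z * Real.exp (-(c * normSq3 z / (1 + normSq3 z)))) = f (WithLp.toLp 2 z) := by
    intro z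
    rw [hf]
    simp only [e, gnomonicWeight, inv_pow]
  calc ∫⁻ z : Fin 3 → ℝ, ENNReal.ofReal (gnomonicWeight z * Real.exp (-(c * normSq3 z / (1 + normSq3 z))))
      = ∫⁻ z : Fin 3 → ℝ, f (WithLp.toLp 2 z) := lintegral_congr key
    _ = ∫⁻ w, f w := h
    _ ≤ _ := by rw [hf]; exact lintegral_zLetter_le hc

/-! ## §2 The leader Tonelli chain in block letters `(u, ((t, v), (z, F)))` -/

/-- ★★★ **THE LEADER FUBINI BOUND IN BLOCK LETTERS.** On `(ℝ × ℝ) × (((Fin 3 → ℝ) × (Fin 2 → ℝ)) × ((Fin 3 → ℝ) × (Fol L → Fin 3 → ℝ)))`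
(w2's B-chart blocks: `u` the transverse `x`-plane, `t = (δ, x₀, y₀)`, `v = y⊥`, `z`, followers `F`), let `G ≥ 0` be measurable and suppose that AFTER the
follower integral it is dominated, at every leader point with `t 0 ∈ S`, by `W(t)·[(A_x+|u|²)^{-2}e^{−c₁ r(t)|u|²/(A_x+|u|²)]·[(A_y+|v|²)^{-2}e^{−c₂|v|²/(A_y+|v|²)]·
[gnomonicWeight z·e^{−c₃|z|²/(1+|z|²)}]` (`A_x = 1 + t1²`, `A_y = 1 + t2²`; `r > 0` a.e.).  Then
`∫⁻_{t 0 ∈ S} G ≤ (π²/c₁)(π²/c₂)(2C₃/((1+c₃)√(1+c₃)))·∫⁻_{S × ℝ²} W(p)·(1+x₀²)⁻¹(1+y₀²)⁻¹·r(p)⁻¹ dp` — `u` FIRST (✓`lintegral_uFirst_le`),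
then `v` (same), `z` (✓`lintegral_zLetter_le`), leaving the 3-letter slab (✓`lintegral_endSlab_le` when `r = B₀`). [folklore] -/
theorem lintegral_blocks_leader_le {S : Set ℝ} (hS : MeasurableSet S) {c₁ c₂ c₃ : ℝ} (hc₁ : 0 < c₁) (hc₂ : 0 < c₂) (hc₃ : 0 < c₃)
    (G : (ℝ × ℝ) × (((Fin 3 → ℝ) × (Fin 2 → ℝ)) × ((Fin 3 → ℝ) × (Fol L → Fin 3 → ℝ))) → ℝ≥0∞) (hG : Measurable G)
    (W : ℝ × ℝ × ℝ → ℝ≥0∞) (hW : Measurable W) (r : ℝ × ℝ × ℝ → ℝ) (hr : Measurable r) (hr0 : ∀ᵐ p : ℝ × ℝ × ℝ, 0 < r p)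
    (hF : ∀ (u : ℝ × ℝ) (t : Fin 3 → ℝ) (v : Fin 2 → ℝ) (z : Fin 3 → ℝ), t 0 ∈ S →
      ∫⁻ F : Fol L → Fin 3 → ℝ, G (u, ((t, v), (z, F))) ≤
        W (t 0, t 1, t 2) *
          ENNReal.ofReal (((1 + t 1 ^ 2 + (u.1 ^ 2 + u.2 ^ 2)) ^ 2)⁻¹ * Real.exp (-(c₁ * r (t 0, t 1, t 2) * (u.1 ^ 2 + u.2 ^ 2) / (1 + t 1 ^ 2 + (u.1 ^ 2 + u.2 ^ 2))))) *
          ENNReal.ofReal (((1 + t 2 ^ 2 + (v 0 ^ 2 + v 1 ^ 2)) ^ 2)⁻¹ * Real.exp (-(c₂ * (v 0 ^ 2 + v 1 ^ 2) / (1 + t 2 ^ 2 + (v 0 ^ 2 + v 1 ^ 2))))) *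
          ENNReal.ofReal (gnomonicWeight z * Real.exp (-(c₃ * normSq3 z / (1 + normSq3 z))))) :
    ∫⁻ q in (univ : Set (ℝ × ℝ)) ×ˢ ((({t : Fin 3 → ℝ | t 0 ∈ S}) ×ˢ (univ : Set (Fin 2 → ℝ))) ×ˢ (univ : Set ((Fin 3 → ℝ) × (Fol L → Fin 3 → ℝ)))), G q ≤
      ENNReal.ofReal (π ^ 2 / c₁ * (π ^ 2 / c₂) * (2 * (∫ w : EuclideanSpace ℝ (Fin 3), ((1 + ‖w‖ ^ 2) ^ 2)⁻¹) / ((1 + c₃) * Real.sqrt (1 + c₃)))) *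
        ∫⁻ p in S ×ˢ (univ : Set (ℝ × ℝ)), W p * ENNReal.ofReal ((1 + p.2.1 ^ 2)⁻¹ * (1 + p.2.2 ^ 2)⁻¹ * (r p)⁻¹) := by
  -- names for the three one-block factors and their integrals
  set Z₃ : ℝ := 2 * (∫ w : EuclideanSpace ℝ (Fin 3), ((1 + ‖w‖ ^ 2) ^ 2)⁻¹) / ((1 + c₃) * Real.sqrt (1 + c₃)) with hZ₃
  set Ux : ℝ × ℝ → (Fin 3 → ℝ) → ℝ≥0∞ := fun u t =>
    ENNReal.ofReal (((1 + t 1 ^ 2 + (u.1 ^ 2 + u.2 ^ 2)) ^ 2)⁻¹ * Real.exp (-(c₁ * r (t 0, t 1, t 2) * (u.1 ^ 2 + u.2 ^ 2) / (1 + t 1 ^ 2 + (u.1 ^ 2 + u.2 ^ 2))))) with hUx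
  set Vy : (Fin 3 → ℝ) → (Fin 2 → ℝ) → ℝ≥0∞ := fun t v =>
    ENNReal.ofReal (((1 + t 2 ^ 2 + (v 0 ^ 2 + v 1 ^ 2)) ^ 2)⁻¹ * Real.exp (-(c₂ * (v 0 ^ 2 + v 1 ^ 2) / (1 + t 2 ^ 2 + (v 0 ^ 2 + v 1 ^ 2))))) with hVy
  set Zz : (Fin 3 → ℝ) → ℝ≥0∞ := fun z => ENNReal.ofReal (gnomonicWeight z * Real.exp (-(c₃ * normSq3 z / (1 + normSq3 z)))) with hZz
  set Wt : (Fin 3 → ℝ) → ℝ≥0∞ := fun t => W (t 0, t 1, t 2) with hWt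
  have hUxm : Measurable (Function.uncurry Ux) := by
    rw [hUx]; exact Measurable.ennreal_ofReal (by fun_prop)
  have hVym : Measurable (Function.uncurry Vy) := by
    rw [hVy]; exact Measurable.ennreal_ofReal (by fun_prop)
  have hnc : Continuous normSq3 := by unfold normSq3; fun_prop
  have hZzm : Measurable Zz := by
    rw [hZz]
    exact Measurable.ennreal_ofReal ((Gnomonic.continuous_gnomonicWeight.measurable).mul (by fun_prop))
  have hWtm : Measurable Wt := by rw [hWt]; exact hW.comp (by fun_prop)
  have hZ : ∫⁻ z, Zz z ≤ ENNReal.ofReal Z₃ := by rw [hZz, hZ₃]; exact lintegral_zLetter_pi_le hc₃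
  have hV : ∀ t : Fin 3 → ℝ, ∫⁻ v, Vy t v ≤ ENNReal.ofReal (π ^ 2 / ((1 + t 2 ^ 2) * c₂)) := fun t => by
    rw [hVy]; exact lintegral_plane_pi_le (by positivity) hc₂
  have hU : ∀ t : Fin 3 → ℝ, 0 < r (t 0, t 1, t 2) → ∫⁻ u, Ux u t ≤ ENNReal.ofReal (π ^ 2 / ((1 + t 1 ^ 2) * (c₁ * r (t 0, t 1, t 2)))) := fun t ht => by
    rw [hUx]
    exact lintegral_uFirst_le (A := 1 + t 1 ^ 2) (κ := c₁ * r (t 0, t 1, t 2)) (by positivity) (mul_pos hc₁ ht)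
  have hF' : ∀ (u : ℝ × ℝ) (t : Fin 3 → ℝ) (v : Fin 2 → ℝ) (z : Fin 3 → ℝ), t 0 ∈ S →
      ∫⁻ F : Fol L → Fin 3 → ℝ, G (u, ((t, v), (z, F))) ≤ Wt t * Ux u t * Vy t v * Zz z := by
    intro u t v z ht
    rw [hWt, hUx, hVy, hZz]
    exact hF u t v z ht
  have hZ₃0 : 0 ≤ Z₃ := by
    rw [hZ₃]
    have : 0 ≤ ∫ w : EuclideanSpace ℝ (Fin 3), ((1 + ‖w‖ ^ 2) ^ 2)⁻¹ := integral_nonneg fun w => by positivity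
    positivity
  -- measurability of the composite factors (stated with the blocks opaque)
  clear_value Ux Vy Zz Wt Z₃
  clear hF hUx hVy hZz
  have hUx_t : ∀ u : ℝ × ℝ, Measurable fun t : Fin 3 → ℝ => Ux u t := fun u => hUxm.comp (measurable_const.prodMk measurable_id)
  have hUx_u : ∀ t : Fin 3 → ℝ, Measurable fun u : ℝ × ℝ => Ux u t := fun t => hUxm.comp (measurable_id.prodMk measurable_const)
  have hVy_v : ∀ t : Fin 3 → ℝ, Measurable fun v : Fin 2 → ℝ => Vy t v := fun t => hVym.comp (measurable_const.prodMk measurable_id)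
  have hm_tv : ∀ u : ℝ × ℝ, Measurable fun tv : (Fin 3 → ℝ) × (Fin 2 → ℝ) => Wt tv.1 * Ux u tv.1 * Vy tv.1 tv.2 * ENNReal.ofReal Z₃ := by
    intro u
    have a : Measurable fun tv : (Fin 3 → ℝ) × (Fin 2 → ℝ) => Wt tv.1 := hWtm.comp measurable_fst
    have b : Measurable fun tv : (Fin 3 → ℝ) × (Fin 2 → ℝ) => Ux u tv.1 := (hUx_t u).comp measurable_fst
    have c : Measurable fun tv : (Fin 3 → ℝ) × (Fin 2 → ℝ) => Vy tv.1 tv.2 := hVym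
    exact ((a.mul b).mul c).mul measurable_const
  have hc_t : Measurable fun t : Fin 3 → ℝ => ENNReal.ofReal (π ^ 2 / ((1 + t 2 ^ 2) * c₂)) := Measurable.ennreal_ofReal (by fun_prop)
  -- the set
  set T : Set (Fin 3 → ℝ) := {t : Fin 3 → ℝ | t 0 ∈ S} with hT
  have hTm : MeasurableSet T := by rw [hT]; exact measurableSet_preimage (measurable_pi_apply 0) hS
  -- Step 1: Tonelli `u` outermost
  have step1 : ∫⁻ q in (univ : Set (ℝ × ℝ)) ×ˢ ((T ×ˢ (univ : Set (Fin 2 → ℝ))) ×ˢ (univ : Set ((Fin 3 → ℝ) × (Fol L → Fin 3 → ℝ)))), G q =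
      ∫⁻ u, ∫⁻ b in (T ×ˢ (univ : Set (Fin 2 → ℝ))) ×ˢ (univ : Set ((Fin 3 → ℝ) × (Fol L → Fin 3 → ℝ))), G (u, b) := by
    rw [Measure.volume_eq_prod, setLIntegral_prod _ (hG.aemeasurable), Measure.restrict_univ]
  -- Step 2: for fixed `u`, the fibre blocks
  have step2 : ∀ u : ℝ × ℝ, ∫⁻ b in (T ×ˢ (univ : Set (Fin 2 → ℝ))) ×ˢ (univ : Set ((Fin 3 → ℝ) × (Fol L → Fin 3 → ℝ))), G (u, b) ≤
      ∫⁻ t in T, Wt t * ENNReal.ofReal (π ^ 2 / ((1 + t 2 ^ 2) * c₂)) * ENNReal.ofReal Z₃ * Ux u t := by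
    intro u
    have hGu : Measurable fun b : ((Fin 3 → ℝ) × (Fin 2 → ℝ)) × ((Fin 3 → ℝ) × (Fol L → Fin 3 → ℝ)) => G (u, b) := hG.comp (by fun_prop)
    rw [Measure.volume_eq_prod, setLIntegral_prod _ hGu.aemeasurable, Measure.restrict_univ]
    -- inner `(z, F)` block
    have inner : ∀ tv : (Fin 3 → ℝ) × (Fin 2 → ℝ), tv.1 0 ∈ S →
        ∫⁻ zF : (Fin 3 → ℝ) × (Fol L → Fin 3 → ℝ), G (u, (tv, zF)) ≤ Wt tv.1 * Ux u tv.1 * Vy tv.1 tv.2 * ENNReal.ofReal Z₃ := by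
      intro tv htv
      have hGtv : Measurable fun zF : (Fin 3 → ℝ) × (Fol L → Fin 3 → ℝ) => G (u, (tv, zF)) := hG.comp (by fun_prop)
      rw [Measure.volume_eq_prod, lintegral_prod _ hGtv.aemeasurable]
      calc ∫⁻ z, ∫⁻ F, G (u, (tv, (z, F))) ≤ ∫⁻ z, Wt tv.1 * Ux u tv.1 * Vy tv.1 tv.2 * Zz z := by
            refine lintegral_mono fun z => ?_
            exact hF' u tv.1 tv.2 z htv
        _ = Wt tv.1 * Ux u tv.1 * Vy tv.1 tv.2 * ∫⁻ z, Zz z := by rw [lintegral_const_mul (f := Zz) _ hZzm]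
        _ ≤ Wt tv.1 * Ux u tv.1 * Vy tv.1 tv.2 * ENNReal.ofReal Z₃ := mul_le_mul_right hZ _
    -- the `(t, v)` block
    calc ∫⁻ tv in T ×ˢ (univ : Set (Fin 2 → ℝ)), ∫⁻ zF, G (u, (tv, zF))
        ≤ ∫⁻ tv in T ×ˢ (univ : Set (Fin 2 → ℝ)), Wt tv.1 * Ux u tv.1 * Vy tv.1 tv.2 * ENNReal.ofReal Z₃ :=
          setLIntegral_mono' (hTm.prod MeasurableSet.univ) fun tv htv => inner tv (mem_prod.1 htv).1
      _ = ∫⁻ t in T, ∫⁻ v, Wt t * Ux u t * Vy t v * ENNReal.ofReal Z₃ := by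
          rw [Measure.volume_eq_prod, setLIntegral_prod _ (hm_tv u).aemeasurable, Measure.restrict_univ]
      _ ≤ ∫⁻ t in T, Wt t * ENNReal.ofReal (π ^ 2 / ((1 + t 2 ^ 2) * c₂)) * ENNReal.ofReal Z₃ * Ux u t := by
          refine lintegral_mono fun t => ?_
          have e : ∀ v, Wt t * Ux u t * Vy t v * ENNReal.ofReal Z₃ = (Wt t * Ux u t * ENNReal.ofReal Z₃) * Vy t v := fun v => by ring
          simp_rw [e]
          rw [lintegral_const_mul (f := fun v : Fin 2 → ℝ => Vy t v) _ (hVy_v t)]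
          calc Wt t * Ux u t * ENNReal.ofReal Z₃ * ∫⁻ v, Vy t v ≤ Wt t * Ux u t * ENNReal.ofReal Z₃ * ENNReal.ofReal (π ^ 2 / ((1 + t 2 ^ 2) * c₂)) :=
                mul_le_mul_right (hV t) _
            _ = _ := by ring
  -- Step 3: swap `u` and `t`, integrate `u`
  have hΦm : Measurable (Function.uncurry fun (u : ℝ × ℝ) (t : Fin 3 → ℝ) => Wt t * ENNReal.ofReal (π ^ 2 / ((1 + t 2 ^ 2) * c₂)) * ENNReal.ofReal Z₃ * Ux u t) := by
    have a : Measurable fun q : (ℝ × ℝ) × (Fin 3 → ℝ) => Wt q.2 := hWtm.comp measurable_snd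
    have b : Measurable fun q : (ℝ × ℝ) × (Fin 3 → ℝ) => ENNReal.ofReal (π ^ 2 / ((1 + q.2 2 ^ 2) * c₂)) := hc_t.comp measurable_snd
    have c : Measurable fun q : (ℝ × ℝ) × (Fin 3 → ℝ) => Ux q.1 q.2 := hUxm
    exact ((a.mul b).mul measurable_const).mul c
  have step3 : ∫⁻ u : ℝ × ℝ, ∫⁻ t in T, Wt t * ENNReal.ofReal (π ^ 2 / ((1 + t 2 ^ 2) * c₂)) * ENNReal.ofReal Z₃ * Ux u t =
      ∫⁻ t in T, Wt t * ENNReal.ofReal (π ^ 2 / ((1 + t 2 ^ 2) * c₂)) * ENNReal.ofReal Z₃ * ∫⁻ u : ℝ × ℝ, Ux u t := by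
    rw [lintegral_lintegral_swap hΦm.aemeasurable]
    refine lintegral_congr fun t => ?_
    rw [lintegral_const_mul (f := fun u : ℝ × ℝ => Ux u t) _ (hUx_u t)]
  -- Step 4: the `u`-integral, a.e. in `t`
  have hsplit : MeasurePreserving (fun t : Fin 3 → ℝ => (t 0, (t 1, t 2))) volume volume := volume_preserving_splitT
  have hr0' : ∀ᵐ t : Fin 3 → ℝ, 0 < r (t 0, t 1, t 2) := hsplit.quasiMeasurePreserving.ae hr0
  have step4 : ∫⁻ t in T, Wt t * ENNReal.ofReal (π ^ 2 / ((1 + t 2 ^ 2) * c₂)) * ENNReal.ofReal Z₃ * ∫⁻ u : ℝ × ℝ, Ux u t ≤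
      ∫⁻ t in T, Wt t * ENNReal.ofReal (π ^ 2 / ((1 + t 2 ^ 2) * c₂)) * ENNReal.ofReal Z₃ * ENNReal.ofReal (π ^ 2 / ((1 + t 1 ^ 2) * (c₁ * r (t 0, t 1, t 2)))) := by
    refine lintegral_mono_ae ((ae_restrict_of_ae hr0').mono fun t ht => ?_)
    exact mul_le_mul_right (hU t ht) _
  -- Step 5: read the `t`-integral on `ℝ × ℝ × ℝ`
  have step5 : ∫⁻ t in T, Wt t * ENNReal.ofReal (π ^ 2 / ((1 + t 2 ^ 2) * c₂)) * ENNReal.ofReal Z₃ * ENNReal.ofReal (π ^ 2 / ((1 + t 1 ^ 2) * (c₁ * r (t 0, t 1, t 2)))) =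
      ∫⁻ p in S ×ˢ (univ : Set (ℝ × ℝ)), W p * ENNReal.ofReal (π ^ 2 / ((1 + p.2.2 ^ 2) * c₂)) * ENNReal.ofReal Z₃ * ENNReal.ofReal (π ^ 2 / ((1 + p.2.1 ^ 2) * (c₁ * r p))) := by
    have hpre : (fun t : Fin 3 → ℝ => (t 0, (t 1, t 2))) ⁻¹' (S ×ˢ (univ : Set (ℝ × ℝ))) = T := by
      ext t; simp [hT]
    rw [← hpre, hWt]
    exact hsplit.setLIntegral_comp_preimage (hS.prod MeasurableSet.univ)
      (f := fun p : ℝ × ℝ × ℝ => W p * ENNReal.ofReal (π ^ 2 / ((1 + p.2.2 ^ 2) * c₂)) * ENNReal.ofReal Z₃ * ENNReal.ofReal (π ^ 2 / ((1 + p.2.1 ^ 2) * (c₁ * r p))))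
      (((hW.mul (Measurable.ennreal_ofReal (by fun_prop))).mul measurable_const).mul (Measurable.ennreal_ofReal (by fun_prop)))
  -- Step 6: constants out
  have step6 : ∫⁻ p in S ×ˢ (univ : Set (ℝ × ℝ)), W p * ENNReal.ofReal (π ^ 2 / ((1 + p.2.2 ^ 2) * c₂)) * ENNReal.ofReal Z₃ * ENNReal.ofReal (π ^ 2 / ((1 + p.2.1 ^ 2) * (c₁ * r p))) ≤
      ENNReal.ofReal (π ^ 2 / c₁ * (π ^ 2 / c₂) * Z₃) * ∫⁻ p in S ×ˢ (univ : Set (ℝ × ℝ)), W p * ENNReal.ofReal ((1 + p.2.1 ^ 2)⁻¹ * (1 + p.2.2 ^ 2)⁻¹ * (r p)⁻¹) := by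
    rw [← lintegral_const_mul (f := fun p : ℝ × ℝ × ℝ => W p * ENNReal.ofReal ((1 + p.2.1 ^ 2)⁻¹ * (1 + p.2.2 ^ 2)⁻¹ * (r p)⁻¹)) _
      (by exact hW.mul (Measurable.ennreal_ofReal (by fun_prop)))]
    refine lintegral_mono fun p => le_of_eq ?_
    have e1 : W p * ENNReal.ofReal (π ^ 2 / ((1 + p.2.2 ^ 2) * c₂)) * ENNReal.ofReal Z₃ * ENNReal.ofReal (π ^ 2 / ((1 + p.2.1 ^ 2) * (c₁ * r p))) =
        W p * (ENNReal.ofReal (π ^ 2 / ((1 + p.2.2 ^ 2) * c₂)) * ENNReal.ofReal Z₃ * ENNReal.ofReal (π ^ 2 / ((1 + p.2.1 ^ 2) * (c₁ * r p)))) := by ring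
    have hA : 0 ≤ π ^ 2 / ((1 + p.2.2 ^ 2) * c₂) := by positivity
    have hK : 0 ≤ π ^ 2 / c₁ * (π ^ 2 / c₂) * Z₃ := mul_nonneg (by positivity) hZ₃0
    have e2 : ENNReal.ofReal (π ^ 2 / ((1 + p.2.2 ^ 2) * c₂)) * ENNReal.ofReal Z₃ * ENNReal.ofReal (π ^ 2 / ((1 + p.2.1 ^ 2) * (c₁ * r p))) =
        ENNReal.ofReal (π ^ 2 / c₁ * (π ^ 2 / c₂) * Z₃) * ENNReal.ofReal ((1 + p.2.1 ^ 2)⁻¹ * (1 + p.2.2 ^ 2)⁻¹ * (r p)⁻¹) := by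
      rw [← ENNReal.ofReal_mul hA, ← ENNReal.ofReal_mul (mul_nonneg hA hZ₃0), ← ENNReal.ofReal_mul hK]
      congr 1
      rw [div_eq_mul_inv, div_eq_mul_inv, div_eq_mul_inv, div_eq_mul_inv, mul_inv, mul_inv, mul_inv]
      ring
    rw [e1, e2]; ring
  calc ∫⁻ q in (univ : Set (ℝ × ℝ)) ×ˢ ((T ×ˢ (univ : Set (Fin 2 → ℝ))) ×ˢ (univ : Set ((Fin 3 → ℝ) × (Fol L → Fin 3 → ℝ)))), G q
      = ∫⁻ u, ∫⁻ b in (T ×ˢ (univ : Set (Fin 2 → ℝ))) ×ˢ (univ : Set ((Fin 3 → ℝ) × (Fol L → Fin 3 → ℝ))), G (u, b) := step1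
    _ ≤ ∫⁻ u : ℝ × ℝ, ∫⁻ t in T, Wt t * ENNReal.ofReal (π ^ 2 / ((1 + t 2 ^ 2) * c₂)) * ENNReal.ofReal Z₃ * Ux u t := lintegral_mono step2
    _ = _ := step3
    _ ≤ _ := step4
    _ = _ := step5
    _ ≤ _ := step6

/-! ## §3 The same bound read on `ℝ × GnoCoord L` against `μ_B` (w2's B-chart ✓`gnoFibreBEquiv`) -/

/-- The point of `ℝ × GnoCoord L` with block letters `(u, ((t, v), (z, F)))` — `gnoFibreBEquiv` read through `gnoFibreBBlocksEquiv` (by `rfl`). [folklore] -/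
theorem gnoFibreBEquiv_eq_blocks (q : (ℝ × ℝ) × GnoFibreB L) :
    gnoFibreBEquiv q = ((gnoFibreBBlocksEquiv q.2).1.1 0,
      ((((![(gnoFibreBBlocksEquiv q.2).1.1 1, q.1.1, q.1.2] : Fin 3 → ℝ), (![(gnoFibreBBlocksEquiv q.2).1.1 2, (gnoFibreBBlocksEquiv q.2).1.2 0, (gnoFibreBBlocksEquiv q.2).1.2 1] : Fin 3 → ℝ)),
        ((gnoFibreBBlocksEquiv q.2).2.1, (gnoFibreBBlocksEquiv q.2).2.2)) : GnoCoord L)) := rfl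

/-- Measurability of the block-letter point map `(u, ((t, v), (z, F))) ↦ (t 0, ((t 1, u), (t 2, v)), z, F)`. [folklore] -/
theorem measurable_blockPoint :
    Measurable fun q : (ℝ × ℝ) × (((Fin 3 → ℝ) × (Fin 2 → ℝ)) × ((Fin 3 → ℝ) × (Fol L → Fin 3 → ℝ))) =>
      ((q.2.1.1 0, ((((![q.2.1.1 1, q.1.1, q.1.2] : Fin 3 → ℝ), (![q.2.1.1 2, q.2.1.2 0, q.2.1.2 1] : Fin 3 → ℝ)), (q.2.2.1, q.2.2.2)) : GnoCoord L)) : ℝ × GnoCoord L) := by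
  have e : (fun q : (ℝ × ℝ) × (((Fin 3 → ℝ) × (Fin 2 → ℝ)) × ((Fin 3 → ℝ) × (Fol L → Fin 3 → ℝ))) =>
      ((q.2.1.1 0, ((((![q.2.1.1 1, q.1.1, q.1.2] : Fin 3 → ℝ), (![q.2.1.1 2, q.2.1.2 0, q.2.1.2 1] : Fin 3 → ℝ)), (q.2.2.1, q.2.2.2)) : GnoCoord L)) : ℝ × GnoCoord L)) =
      (gnoFibreBEquiv (L := L)) ∘ (fun q => (q.1, (gnoFibreBBlocksEquiv (L := L)).symm q.2)) := by
    funext q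
    rw [Function.comp_apply, gnoFibreBEquiv_eq_blocks]
    simp only [MeasurableEquiv.apply_symm_apply]
  rw [e]
  exact (gnoFibreBEquiv (L := L)).measurable.comp (measurable_fst.prodMk ((gnoFibreBBlocksEquiv (L := L)).symm.measurable.comp measurable_snd))

/-- ★★★ **THE LEADER FUBINI BOUND ON A HUB SLAB OF `μ_B`.** For a measurable hub set `S ⊆ ℝ` and a measurable `g ≥ 0` on `ℝ × GnoCoord L`, IF at every leader point
`(δ, x₀, u, y₀, v, z)` with `δ ∈ S` the follower integral of `J_B·g` (with `J_B = ((1+δ²)⁻¹)²·gnoDensity`) is dominated by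
`W(δ,x₀,y₀)·[(1+x₀²+|u|²)^{-2}e^{−c₁ r|u|²/(1+x₀²+|u|²)]·[(1+y₀²+|v|²)^{-2}e^{−c₂|v|²/(1+y₀²+|v|²)]·[gnomonicWeight z·e^{−c₃|z|²/(1+|z|²)}]` (`r > 0` a.e.), THEN
`∫⁻_{δ ∈ S} g dμ_B ≤ (π²/c₁)(π²/c₂)(2C₃/((1+c₃)√(1+c₃)))·∫⁻_{S×ℝ²} W·(1+x₀²)⁻¹(1+y₀²)⁻¹·r⁻¹` — the leader side of the end-core Gaussian half, to be fed with
`S = ` the end window, `r = B₀`, `W = ` the matched follower factor, and closed by ✓`lintegral_endSlab_le`. [folklore] -/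
theorem lintegral_hubSlab_leader_le {S : Set ℝ} (hS : MeasurableSet S) {c₁ c₂ c₃ : ℝ} (hc₁ : 0 < c₁) (hc₂ : 0 < c₂) (hc₃ : 0 < c₃)
    (g : ℝ × GnoCoord L → ℝ≥0∞) (hg : Measurable g)
    (W : ℝ × ℝ × ℝ → ℝ≥0∞) (hW : Measurable W) (r : ℝ × ℝ × ℝ → ℝ) (hr : Measurable r) (hr0 : ∀ᵐ p : ℝ × ℝ × ℝ, 0 < r p)
    (hF : ∀ (u : ℝ × ℝ) (t : Fin 3 → ℝ) (v : Fin 2 → ℝ) (z : Fin 3 → ℝ), t 0 ∈ S →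
      ∫⁻ F : Fol L → Fin 3 → ℝ,
          ENNReal.ofReal (((1 + (t 0) ^ 2)⁻¹) ^ 2 * gnoDensity ((((![t 1, u.1, u.2] : Fin 3 → ℝ), (![t 2, v 0, v 1] : Fin 3 → ℝ)), (z, F)) : GnoCoord L)) *
            g (t 0, ((((![t 1, u.1, u.2] : Fin 3 → ℝ), (![t 2, v 0, v 1] : Fin 3 → ℝ)), (z, F)) : GnoCoord L)) ≤
        W (t 0, t 1, t 2) *
          ENNReal.ofReal (((1 + t 1 ^ 2 + (u.1 ^ 2 + u.2 ^ 2)) ^ 2)⁻¹ * Real.exp (-(c₁ * r (t 0, t 1, t 2) * (u.1 ^ 2 + u.2 ^ 2) / (1 + t 1 ^ 2 + (u.1 ^ 2 + u.2 ^ 2))))) *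
          ENNReal.ofReal (((1 + t 2 ^ 2 + (v 0 ^ 2 + v 1 ^ 2)) ^ 2)⁻¹ * Real.exp (-(c₂ * (v 0 ^ 2 + v 1 ^ 2) / (1 + t 2 ^ 2 + (v 0 ^ 2 + v 1 ^ 2))))) *
          ENNReal.ofReal (gnomonicWeight z * Real.exp (-(c₃ * normSq3 z / (1 + normSq3 z))))) :
    ∫⁻ p in {p : ℝ × GnoCoord L | p.1 ∈ S}, g p ∂((volume : Measure (ℝ × GnoCoord L)).withDensity fun p => ENNReal.ofReal (((1 + p.1 ^ 2)⁻¹) ^ 2 * gnoDensity p.2)) ≤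
      ENNReal.ofReal (π ^ 2 / c₁ * (π ^ 2 / c₂) * (2 * (∫ w : EuclideanSpace ℝ (Fin 3), ((1 + ‖w‖ ^ 2) ^ 2)⁻¹) / ((1 + c₃) * Real.sqrt (1 + c₃)))) *
        ∫⁻ p in S ×ˢ (univ : Set (ℝ × ℝ)), W p * ENNReal.ofReal ((1 + p.2.1 ^ 2)⁻¹ * (1 + p.2.2 ^ 2)⁻¹ * (r p)⁻¹) := by
  -- the block-letter integrand
  set pt : (ℝ × ℝ) × (((Fin 3 → ℝ) × (Fin 2 → ℝ)) × ((Fin 3 → ℝ) × (Fol L → Fin 3 → ℝ))) → ℝ × GnoCoord L := fun q =>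
    ((q.2.1.1 0, ((((![q.2.1.1 1, q.1.1, q.1.2] : Fin 3 → ℝ), (![q.2.1.1 2, q.2.1.2 0, q.2.1.2 1] : Fin 3 → ℝ)), (q.2.2.1, q.2.2.2)) : GnoCoord L)) : ℝ × GnoCoord L) with hpt
  have hptm : Measurable pt := by rw [hpt]; exact measurable_blockPoint
  set ρ : ℝ × GnoCoord L → ℝ≥0∞ := fun p => ENNReal.ofReal (((1 + p.1 ^ 2)⁻¹) ^ 2 * gnoDensity p.2) with hρ
  have hρm : Measurable ρ := by rw [hρ]; exact ENNReal.measurable_ofReal.comp measurable_bDensity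
  set G : (ℝ × ℝ) × (((Fin 3 → ℝ) × (Fin 2 → ℝ)) × ((Fin 3 → ℝ) × (Fol L → Fin 3 → ℝ))) → ℝ≥0∞ := fun q => ρ (pt q) * g (pt q) with hG
  have hGm : Measurable G := by rw [hG]; exact (hρm.comp hptm).mul (hg.comp hptm)
  -- Step A: pull back along the B-chart
  set e := gnoFibreBEquiv (L := L) with he
  have hA : {p : ℝ × GnoCoord L | p.1 ∈ S} = e '' (e ⁻¹' {p : ℝ × GnoCoord L | p.1 ∈ S}) := (image_preimage_eq _ e.surjective).symm
  have hpre : e ⁻¹' {p : ℝ × GnoCoord L | p.1 ∈ S} = (univ : Set (ℝ × ℝ)) ×ˢ {y : GnoFibreB L | y (Sum.inl (Sum.inl 0)) ∈ S} := by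
    ext q
    simp only [mem_preimage, mem_setOf_eq, mem_prod, mem_univ, true_and, he, gnoFibreBEquiv_apply']
  have hYm : MeasurableSet {y : GnoFibreB L | y (Sum.inl (Sum.inl 0)) ∈ S} := by
    have : Measurable fun y : GnoFibreB L => y (Sum.inl (Sum.inl 0)) := by fun_prop
    exact this hS
  set ν : Measure ((ℝ × ℝ) × GnoFibreB L) := (volume : Measure (ℝ × ℝ)).prod (volume : Measure (GnoFibreB L)) with hν
  have stepA : ∫⁻ p in {p : ℝ × GnoCoord L | p.1 ∈ S}, g p ∂((volume : Measure (ℝ × GnoCoord L)).withDensity ρ) =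
      ∫⁻ q in (univ : Set (ℝ × ℝ)) ×ˢ {y : GnoFibreB L | y (Sum.inl (Sum.inl 0)) ∈ S}, ρ (e q) * g (e q) ∂ν := by
    rw [volume_withDensity_eq_map_gnoFibreBEquiv hρm, ← he, e.measurableEmbedding.restrict_map, lintegral_map_equiv, hpre,
      restrict_withDensity (MeasurableSet.univ.prod hYm),
      lintegral_withDensity_eq_lintegral_mul _ (hρm.comp e.measurable) (show Measurable (fun a => g (e a)) from hg.comp e.measurable)]
    rfl
  -- Step B: read the fibre through the blocks (measure preserving)
  set Φ : (ℝ × ℝ) × GnoFibreB L → (ℝ × ℝ) × (((Fin 3 → ℝ) × (Fin 2 → ℝ)) × ((Fin 3 → ℝ) × (Fol L → Fin 3 → ℝ))) :=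
    fun q => (q.1, gnoFibreBBlocksEquiv q.2) with hΦ
  have hΦmp : MeasurePreserving Φ ν volume := by
    rw [hΦ, hν]; exact (MeasurePreserving.id volume).prod volume_preserving_gnoFibreBBlocksEquiv
  have hTset : Φ ⁻¹' ((univ : Set (ℝ × ℝ)) ×ˢ ((({t : Fin 3 → ℝ | t 0 ∈ S}) ×ˢ (univ : Set (Fin 2 → ℝ))) ×ˢ (univ : Set ((Fin 3 → ℝ) × (Fol L → Fin 3 → ℝ))))) =
      (univ : Set (ℝ × ℝ)) ×ˢ {y : GnoFibreB L | y (Sum.inl (Sum.inl 0)) ∈ S} := by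
    ext q
    simp only [hΦ, mem_preimage, mem_prod, mem_univ, true_and, and_true, mem_setOf_eq, gnoFibreBBlocksEquiv_apply, gnoFibreBBlocks]
  have heG : ∀ q : (ℝ × ℝ) × GnoFibreB L, ρ (e q) * g (e q) = G (Φ q) := by
    intro q
    rw [hG, hpt, hΦ, he, gnoFibreBEquiv_eq_blocks]
  have stepB : ∫⁻ q in (univ : Set (ℝ × ℝ)) ×ˢ {y : GnoFibreB L | y (Sum.inl (Sum.inl 0)) ∈ S}, ρ (e q) * g (e q) ∂ν =
      ∫⁻ q in (univ : Set (ℝ × ℝ)) ×ˢ ((({t : Fin 3 → ℝ | t 0 ∈ S}) ×ˢ (univ : Set (Fin 2 → ℝ))) ×ˢ (univ : Set ((Fin 3 → ℝ) × (Fol L → Fin 3 → ℝ)))), G q := by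
    simp_rw [heG]
    rw [← hTset]
    exact hΦmp.setLIntegral_comp_preimage (MeasurableSet.univ.prod (((measurableSet_preimage (measurable_pi_apply 0) hS).prod MeasurableSet.univ).prod MeasurableSet.univ)) hGm
  -- Step C: the block lemma
  have hF' : ∀ (u : ℝ × ℝ) (t : Fin 3 → ℝ) (v : Fin 2 → ℝ) (z : Fin 3 → ℝ), t 0 ∈ S →
      ∫⁻ F : Fol L → Fin 3 → ℝ, G (u, ((t, v), (z, F))) ≤
        W (t 0, t 1, t 2) *
          ENNReal.ofReal (((1 + t 1 ^ 2 + (u.1 ^ 2 + u.2 ^ 2)) ^ 2)⁻¹ * Real.exp (-(c₁ * r (t 0, t 1, t 2) * (u.1 ^ 2 + u.2 ^ 2) / (1 + t 1 ^ 2 + (u.1 ^ 2 + u.2 ^ 2))))) *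
          ENNReal.ofReal (((1 + t 2 ^ 2 + (v 0 ^ 2 + v 1 ^ 2)) ^ 2)⁻¹ * Real.exp (-(c₂ * (v 0 ^ 2 + v 1 ^ 2) / (1 + t 2 ^ 2 + (v 0 ^ 2 + v 1 ^ 2))))) *
          ENNReal.ofReal (gnomonicWeight z * Real.exp (-(c₃ * normSq3 z / (1 + normSq3 z)))) := by
    intro u t v z ht
    have h := hF u t v z ht
    rw [hG, hpt, hρ]
    exact h
  rw [stepA, stepB]
  exact lintegral_blocks_leader_le hS hc₁ hc₂ hc₃ G hGm W hW r hr hr0 hF'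

end Summit.QuantumFields.YangMills.Theorems.SwapVirialDeficit.SigmaBall

end
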